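import Summits.NavierStokesRegularity.FunctionalMining.HsTimeAverages
import Literature.Analysis.FluidPDE.TorusWordSpaceTime
import Literature.Analysis.FluidPDE.TorusWordEnergy
import Literature.Analysis.FluidPDE.TorusNSChessboardTimeAverages
import HarnessLib

/-!
# FunctionalMining — word energies vs. the Ḣˢ energies: `∑_{|w|=n} E_s(∂^w v) = E_{s+n}(v)`,
# Gibbon's `H_n = ∫|∇ⁿv|² = E_n(v)`, and the Sobolev / Agmon bounds for `|∇ⁿv|² = ∑_{|w|=n} ‖∂^w v‖²`

Search for candidate a priori estimates; no regularity claim. Cell `pub-nsfunc`, lit seat (gen 16);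
bookkeeping file between the two currencies of higher Sobolev norms on `T³` used by the cell: the
spectral energies `E_s(v) = ∑_k (4π²|k|²)^s ‖v̂(k)‖²` of `HsEnergyBalance` (`torusHsEnergy`, every real
`s ≥ 0`) and the word energies `wordEnergy n v = ∑_{w : Fin n → d} ∫ ‖∂^w v‖²` of
`TorusWordEnergy` (all ordered derivative words of length `n`, i.e. Gibbon's
`H_n = ∫ |∇ⁿv|² dx` with `|∇ⁿv|² = ∑_{i₁…iₙ} ‖∂_{i₁}⋯∂_{iₙ} v‖²`, J. Nonlinear Sci. 29 (2019) (8)). All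
statements are Parseval bookkeeping plus two tree inequalities applied word by word:

* `hasSum_torusHsEnergy` — `E_s(v) = ∑_k σ_s(k)‖v̂(k)‖²` as a `HasSum`; `torusHsEnergy_zero_eq`:
  `E_0(v) = ∫‖v‖²`;
* `sum_torusHsEnergy_partialDeriv` — `∑ᵢ E_s(∂ᵢv) = E_{s+1}(v)` (`𝓕(∂ᵢv)(k) = 2πi kᵢ v̂(k)`,
  `∑ᵢ 4π²kᵢ² = σ_1(k)`, `σ_sσ_1 = σ_{s+1}`);
* `sum_torusHsEnergy_wordDeriv` — `∑_{w : Fin n → d} E_s(∂^w v) = E_{s+n}(v)`; hence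
  `wordEnergy_eq_torusHsEnergy`: **`wordEnergy n v = E_n(v)`** (`H_n = ‖v‖²_{Ḣⁿ}`);
* `hasZeroMean_wordDeriv` — words of a zero-mean field have zero mean;
* `sum_norm_sq_wordDeriv_le_agmon` — **Agmon at every order on `T³`**:
  `|∇ⁿv(x)|² ≤ (2/π²) √E_{n+1}(v) √E_{n+2}(v)` for zero-mean smooth `v` (the tree's
  `‖w‖²_∞ ≤ (2/π²)‖∇w‖₂‖Δw‖₂`, `TorusAgmonExplicit`, on each word + Cauchy–Schwarz over words);
* `exists_integral_cube_sum_norm_sq_wordDeriv_le` — **Sobolev `H¹ ⊂ L⁶` at every order**: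
  `∫ |∇ⁿv|⁶ ≤ C_n E_{n+1}(v)³` for zero-mean smooth `v` (the tree's `∫‖w‖⁶ ≤ C(∫|∇w|²)³`,
  `TorusNSChessboardTimeAverages`, on each word; `(∑_w a_w)³ ≤ N²∑_w a_w³`, `∑_w b_w³ ≤ (∑_w b_w)³`);
* `timeAverage_wordEnergy_le` — **column `m = 1` of Gibbon's chessboard in his notation**: for
  `n ≥ 1`, `ν > 0`, `M ≥ 0` there is `K` with `∫₀ᵀ H_n(u(t))^{1/(2n−1)} dt ≤ K(1+T)` along every
  classical zero-mean solution of unforced Navier–Stokes on `[0,T] × T³` with `‖u(0)‖₂² ≤ M`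
  (`HsTimeAverages.timeAverage_le_nat` rewritten; Foias–Guillopé–Temam 1981 Thm 3.1).

These feed the chessboard squares `(n, m)` (`HsChessboard`). A priori bookkeeping; no regularity claim.

## Mathlib / tree search

Tree (used): `torusHsEnergy_eq_tsum`, `torusHsEnergy_one`, `torusHsEnergy_two`, `summable_hsSymbolSum_term`
(`HsEnergyBalance`, `HsEnergyInequalities`, `HsProductionBoundOne`); `Torus.wordDeriv`, `Torus.wordEnergy`,
`Torus.isSmooth_wordDeriv`, `Torus.hasSum_norm_sq_mFourierCoeff` (`TorusWordSobolev`, `TorusWordEnergy`);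
`Torus.mFourierCoeff_complexify_partialDeriv` (`TorusTrigPoly`); `Torus.hasZeroMean_partialDeriv`;
`Torus.norm_sq_le_two_div_pi_sq_mul_sqrt` (`TorusAgmonExplicit`);
`Torus.exists_integral_norm_pow_six_le_gradNormSq_cube` (`TorusNSChessboardTimeAverages`); Mathlib
`hasSum_sum`, `HasSum.unique`, `Fin.consEquiv`, `Real.sum_sqrt_mul_sqrt_le`, `pow_sum_le_card_mul_sum_pow`.
Searched `wordEnergy.*torusHsEnergy|HsEnergy.*wordDeriv`: nothing (the two currencies were not linked).

## References

* [Gibbon2019Chessboard] J. D. Gibbon, J. Nonlinear Sci. 29 (2019) 215–228, (8) `H_n = ∫|∇ⁿu|²dV`,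
  Thm 1 / Table 1.
* [FoiasGuillopeTemam1981] Comm. PDE 6 (1981) 329–359, Thm 3.1.
* [Majda1984] A. Majda, *Compressible Fluid Flow…*, Springer 1984, Ch. 2 §2.1 (2.8) (word energies).
* [Ayala2014Thesis] D. Ayala, PhD thesis (McMaster 2014), App. A (A.3) (Agmon on `T³`, constant `2/π²`).
-/

noncomputable section

open MeasureTheory Set Filter Topology Function Real intervalIntegral Finset UnitAddTorus
open scoped InnerProductSpace RealInnerProductSpace ENNReal BigOperators

namespace Summit.NavierStokesRegularity.FunctionalMining

open Literature.Analysis Literature.Analysis.FunctionSpaces Literature.Analysis.FluidPDE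
open Literature.Analysis.FunctionSpaces.Torus Literature.Analysis.FluidPDE.Torus

namespace HsWordEnergy

variable {d : Type*} [Fintype d] [DecidableEq d]

/-! ## 1. The Ḣˢ energy as a `HasSum`; order zero -/

/-- `E_s(v) = ∑_k σ_s(k) ‖v̂(k)‖²` as a convergent sum (`s ≥ 0`, smooth `v`). [folklore] -/
theorem hasSum_torusHsEnergy {s : ℝ} (hs : 0 ≤ s) {v : UnitAddTorus d → EuclideanSpace ℝ d}
    (hv : IsSmooth v) :
    HasSum (fun k : d → ℤ => fracSymbol s k * ‖mFourierCoeff (EuclideanSpace.complexify ∘ v) k‖ ^ 2)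
      (torusHsEnergy s v) := by
  rw [torusHsEnergy_eq_tsum hs hv]
  exact (summable_hsSymbolSum_term s hv).hasSum

/-- **`E_0(v) = ∫ ‖v‖²`** for smooth `v` (`σ_0 ≡ 1`, Plancherel). [folklore] -/
theorem torusHsEnergy_zero_eq {v : UnitAddTorus d → EuclideanSpace ℝ d} (hv : IsSmooth v) :
    torusHsEnergy 0 v = ∫ x, ‖v x‖ ^ 2 := by
  have h1 := hasSum_torusHsEnergy le_rfl hv
  have h2 := Torus.hasSum_norm_sq_mFourierCoeff hv
  have e : (fun k : d → ℤ => fracSymbol 0 k * ‖mFourierCoeff (EuclideanSpace.complexify ∘ v) k‖ ^ 2) =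
      fun k : d → ℤ => ‖mFourierCoeff (EuclideanSpace.complexify ∘ v) k‖ ^ 2 := by
    funext k
    rw [fracSymbol, Real.rpow_zero, one_mul]
  rw [e] at h1
  exact h1.unique h2

/-! ## 2. One derivative: `∑ᵢ E_s(∂ᵢv) = E_{s+1}(v)` -/

omit [Fintype d] [DecidableEq d] in
/-- `‖2πi kⱼ‖² = 4π² kⱼ²`. [folklore] -/
theorem norm_sq_deriv_symbol (k : d → ℤ) (j : d) :
    ‖(2 * Real.pi * Complex.I * (k j : ℂ))‖ ^ 2 = 4 * Real.pi ^ 2 * (k j : ℝ) ^ 2 := by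
  have h1 : ‖(2 * Real.pi * Complex.I * (k j : ℂ))‖ = 2 * Real.pi * |(k j : ℝ)| := by
    simp only [norm_mul, Complex.norm_ofNat, Complex.norm_real, Real.norm_eq_abs, Complex.norm_I, mul_one,
      Complex.norm_intCast, abs_of_pos Real.pi_pos]
  rw [h1, mul_pow, mul_pow, sq_abs]
  ring

omit [DecidableEq d] in
/-- `∑ⱼ σ_s(k) ‖2πi kⱼ‖² = σ_{s+1}(k)` (`∑ⱼ 4π²kⱼ² = σ_1(k)`, `σ_sσ_1 = σ_{s+1}`). [folklore] -/
theorem sum_fracSymbol_mul_norm_sq_deriv_symbol {s : ℝ} (hs : 0 ≤ s) (k : d → ℤ) :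
    ∑ j, fracSymbol s k * ‖(2 * Real.pi * Complex.I * (k j : ℂ))‖ ^ 2 = fracSymbol (s + 1) k := by
  simp_rw [norm_sq_deriv_symbol]
  rw [← Finset.mul_sum, ← Finset.mul_sum, fracSymbol_add hs zero_le_one, fracSymbol_one]
  rfl

/-- **`∑ᵢ E_s(∂ᵢv) = E_{s+1}(v)`** for smooth `v` and `s ≥ 0` (`𝓕(∂ᵢv)(k) = 2πi kᵢ v̂(k)`).
[folklore] -/
theorem sum_torusHsEnergy_partialDeriv {s : ℝ} (hs : 0 ≤ s) {v : UnitAddTorus d → EuclideanSpace ℝ d}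
    (hv : IsSmooth v) :
    ∑ j, torusHsEnergy s (Torus.partialDeriv j v) = torusHsEnergy (s + 1) v := by
  have hj : ∀ j, HasSum (fun k : d → ℤ => fracSymbol s k *
      (‖(2 * Real.pi * Complex.I * (k j : ℂ))‖ ^ 2 * ‖mFourierCoeff (EuclideanSpace.complexify ∘ v) k‖ ^ 2))
      (torusHsEnergy s (Torus.partialDeriv j v)) := by
    intro j
    refine (hasSum_torusHsEnergy hs (hv.partialDeriv j)).congr_fun fun k => ?_
    rw [mFourierCoeff_complexify_partialDeriv hv j k, norm_smul, mul_pow]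
  have hsum := hasSum_sum (s := (Finset.univ : Finset d)) fun j _ => hj j
  have e : (fun k : d → ℤ => ∑ j ∈ (Finset.univ : Finset d), fracSymbol s k *
      (‖(2 * Real.pi * Complex.I * (k j : ℂ))‖ ^ 2 * ‖mFourierCoeff (EuclideanSpace.complexify ∘ v) k‖ ^ 2)) =
      fun k : d → ℤ => fracSymbol (s + 1) k * ‖mFourierCoeff (EuclideanSpace.complexify ∘ v) k‖ ^ 2 := by
    funext k
    rw [← sum_fracSymbol_mul_norm_sq_deriv_symbol hs k, Finset.sum_mul]
    refine Finset.sum_congr rfl fun j _ => ?_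
    ring
  rw [e] at hsum
  exact hsum.unique (hasSum_torusHsEnergy (by linarith) hv)

/-! ## 3. Words: `∑_{|w| = n} E_s(∂^w v) = E_{s+n}(v)` and `wordEnergy n v = E_n(v)` -/

/-- **`∑_{w : Fin n → d} E_s(∂^w v) = E_{s+n}(v)`** for smooth `v`, `s ≥ 0` (split off the outer
letter, `∑ᵢ E_s(∂ᵢ ·) = E_{s+1}(·)`, induction). [folklore] -/
theorem sum_torusHsEnergy_wordDeriv {v : UnitAddTorus d → EuclideanSpace ℝ d} (hv : IsSmooth v) :
    ∀ (n : ℕ) {s : ℝ}, 0 ≤ s →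
      ∑ w : Fin n → d, torusHsEnergy s (wordDeriv (List.ofFn w) v) = torusHsEnergy (s + n) v
  | 0, s, _ => by simp
  | n + 1, s, hs => by
    rw [← (Fin.consEquiv fun _ : Fin (n + 1) => d).sum_comp, Fintype.sum_prod_type, Finset.sum_comm]
    have e : ∀ (u : Fin n → d) (i : d),
        wordDeriv (List.ofFn ((Fin.consEquiv fun _ : Fin (n + 1) => d) (i, u))) v =
          Torus.partialDeriv i (wordDeriv (List.ofFn u) v) := fun u i => by
      have : List.ofFn ((Fin.consEquiv fun _ : Fin (n + 1) => d) (i, u)) = i :: List.ofFn u := by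
        simp [Fin.consEquiv]
      rw [this, wordDeriv_cons]
    simp_rw [e]
    have h1 : ∀ u : Fin n → d, ∑ i, torusHsEnergy s (Torus.partialDeriv i (wordDeriv (List.ofFn u) v)) =
        torusHsEnergy (s + 1) (wordDeriv (List.ofFn u) v) := fun u =>
      sum_torusHsEnergy_partialDeriv hs (isSmooth_wordDeriv hv _)
    simp_rw [h1]
    rw [sum_torusHsEnergy_wordDeriv hv n (by linarith : 0 ≤ s + 1), Nat.cast_succ]
    ring_nf

/-- **`wordEnergy n v = E_n(v)`**: Gibbon's `H_n = ∫|∇ⁿv|² = ∑_{|w|=n} ∫‖∂^w v‖²` is the spectral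
energy `‖v‖²_{Ḣⁿ} = ∑_k (4π²|k|²)ⁿ ‖v̂(k)‖²` (smooth `v`). [folklore; Gibbon2019Chessboard (8)] -/
theorem wordEnergy_eq_torusHsEnergy (n : ℕ) {v : UnitAddTorus d → EuclideanSpace ℝ d} (hv : IsSmooth v) :
    wordEnergy n v = torusHsEnergy n v := by
  unfold wordEnergy
  have e : ∀ w : Fin n → d, ∫ x, ‖wordDeriv (List.ofFn w) v x‖ ^ 2 =
      torusHsEnergy 0 (wordDeriv (List.ofFn w) v) := fun w =>
    (torusHsEnergy_zero_eq (isSmooth_wordDeriv hv _)).symm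
  simp_rw [e]
  rw [sum_torusHsEnergy_wordDeriv hv n le_rfl, zero_add]

/-! ## 4. Zero mean, Agmon and Sobolev at every order -/

/-- Word derivatives of a zero-mean smooth field have zero mean. [folklore] -/
theorem hasZeroMean_wordDeriv {v : UnitAddTorus d → EuclideanSpace ℝ d} (hv : IsSmooth v)
    (hmean : HasZeroMean v) : ∀ l : List d, HasZeroMean (wordDeriv l v)
  | [] => hmean
  | i :: l => by
    rw [wordDeriv_cons]
    exact hasZeroMean_partialDeriv (isSmooth_wordDeriv hv l) i

/-- **Agmon's inequality at every order on `T³`** (explicit constant): for a smooth zero-mean field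
`v` on `T^d`, `card d = 3`, every `n` and every point `x`,
`|∇ⁿv(x)|² = ∑_{w : Fin n → d} ‖∂^w v(x)‖² ≤ (2/π²) √E_{n+1}(v) √E_{n+2}(v)`
(the tree's `‖w‖_∞² ≤ (2/π²)‖∇w‖₂‖Δw‖₂` on each zero-mean word `w = ∂^w v`, Cauchy–Schwarz over the
words, `∑_w E_1(∂^w v) = E_{n+1}`, `∑_w E_2(∂^w v) = E_{n+2}`). [cite: Ayala2014Thesis, App. A (A.3)]
(every order; ours as bookkeeping) -/
theorem sum_norm_sq_wordDeriv_le_agmon (hd : Fintype.card d = 3) (n : ℕ)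
    {v : UnitAddTorus d → EuclideanSpace ℝ d} (hv : IsSmooth v) (hmean : HasZeroMean v) (x : UnitAddTorus d) :
    ∑ w : Fin n → d, ‖wordDeriv (List.ofFn w) v x‖ ^ 2 ≤
      2 / π ^ 2 * Real.sqrt (torusHsEnergy (n + 1) v) * Real.sqrt (torusHsEnergy (n + 2) v) := by
  have hw : ∀ w : Fin n → d, IsSmooth (wordDeriv (List.ofFn w) v) := fun w => isSmooth_wordDeriv hv _
  have h1 : ∀ w : Fin n → d, ‖wordDeriv (List.ofFn w) v x‖ ^ 2 ≤ 2 / π ^ 2 *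
      (Real.sqrt (torusHsEnergy 1 (wordDeriv (List.ofFn w) v)) *
        Real.sqrt (torusHsEnergy 2 (wordDeriv (List.ofFn w) v))) := by
    intro w
    have h := norm_sq_le_two_div_pi_sq_mul_sqrt hd (hw w) (hasZeroMean_wordDeriv hv hmean _) x
    rw [← torusHsEnergy_one (hw w), ← torusHsEnergy_two (hw w)] at h
    linarith
  have h2 := Finset.sum_le_sum fun w (_ : w ∈ (Finset.univ : Finset (Fin n → d))) => h1 w
  rw [← Finset.mul_sum] at h2
  have hCS := Real.sum_sqrt_mul_sqrt_le (Finset.univ : Finset (Fin n → d))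
    (f := fun w => torusHsEnergy 1 (wordDeriv (List.ofFn w) v))
    (g := fun w => torusHsEnergy 2 (wordDeriv (List.ofFn w) v))
    (fun w => torusHsEnergy_nonneg zero_le_one (hw w)) (fun w => torusHsEnergy_nonneg (by norm_num) (hw w))
  rw [sum_torusHsEnergy_wordDeriv hv n zero_le_one, sum_torusHsEnergy_wordDeriv hv n (by norm_num)] at hCS
  rw [show (1 : ℝ) + n = n + 1 by ring, show (2 : ℝ) + n = n + 2 by ring] at hCS
  have hπ : 0 ≤ 2 / π ^ 2 := by positivity
  calc ∑ w : Fin n → d, ‖wordDeriv (List.ofFn w) v x‖ ^ 2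
      ≤ 2 / π ^ 2 * ∑ w : Fin n → d, Real.sqrt (torusHsEnergy 1 (wordDeriv (List.ofFn w) v)) *
          Real.sqrt (torusHsEnergy 2 (wordDeriv (List.ofFn w) v)) := h2
    _ ≤ 2 / π ^ 2 * (Real.sqrt (torusHsEnergy (n + 1) v) * Real.sqrt (torusHsEnergy (n + 2) v)) :=
        mul_le_mul_of_nonneg_left hCS hπ
    _ = _ := by ring

omit [DecidableEq d] in
/-- `∑ a_w³ ≤ (∑ a_w)³` for non-negative reals. [folklore] -/
theorem sum_pow_three_le_pow_sum {ι : Type*} (s : Finset ι) {a : ι → ℝ} (ha : ∀ i ∈ s, 0 ≤ a i) :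
    ∑ i ∈ s, a i ^ 3 ≤ (∑ i ∈ s, a i) ^ 3 := by
  have hS : 0 ≤ ∑ i ∈ s, a i := Finset.sum_nonneg ha
  have h1 : ∀ i ∈ s, a i ^ 3 ≤ a i * (∑ j ∈ s, a j) ^ 2 := by
    intro i hi
    have hle : a i ≤ ∑ j ∈ s, a j := Finset.single_le_sum ha hi
    have : a i ^ 2 ≤ (∑ j ∈ s, a j) ^ 2 := pow_le_pow_left₀ (ha i hi) hle 2
    nlinarith [ha i hi]
  calc ∑ i ∈ s, a i ^ 3 ≤ ∑ i ∈ s, a i * (∑ j ∈ s, a j) ^ 2 := Finset.sum_le_sum h1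
    _ = (∑ i ∈ s, a i) ^ 3 := by rw [← Finset.sum_mul]; ring

/-- **Sobolev `H¹ ⊂ L⁶` at every order on `T³`**: for every `n` there is `C ≥ 0` with
`∫ |∇ⁿv|⁶ = ∫ (∑_{w} ‖∂^w v‖²)³ ≤ C · E_{n+1}(v)³` for all smooth zero-mean `v` on `T^d`, `card d = 3`
(the tree's `∫‖w‖⁶ ≤ C₆(∫|∇w|²)³` on each zero-mean word, `(∑_w a_w)³ ≤ N²∑_w a_w³` with
`N = #(Fin n → d)`, and `∑_w E_1(∂^w v)³ ≤ (∑_w E_1(∂^w v))³ = E_{n+1}(v)³`).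
[cite: RobinsonRodrigoSadowskiCUP2016, Thm 1.18 (H¹ ⊂ L⁶ on T³)] (every order; ours as bookkeeping) -/
theorem exists_integral_cube_sum_norm_sq_wordDeriv_le (hd : Fintype.card d = 3) (n : ℕ) :
    ∃ C : ℝ, 0 ≤ C ∧ ∀ v : UnitAddTorus d → EuclideanSpace ℝ d, IsSmooth v → HasZeroMean v →
      ∫ x, (∑ w : Fin n → d, ‖wordDeriv (List.ofFn w) v x‖ ^ 2) ^ 3 ≤
        C * torusHsEnergy (n + 1) v ^ 3 := by
  obtain ⟨C₆, hC₆, h₆⟩ := Torus.exists_integral_norm_pow_six_le_gradNormSq_cube hd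
  set N : ℕ := Fintype.card (Fin n → d) with hN
  refine ⟨(N : ℝ) ^ 2 * C₆, by positivity, fun v hv hmean => ?_⟩
  have hw : ∀ w : Fin n → d, IsSmooth (wordDeriv (List.ofFn w) v) := fun w => isSmooth_wordDeriv hv _
  set g : (Fin n → d) → UnitAddTorus d → ℝ := fun w x => ‖wordDeriv (List.ofFn w) v x‖ ^ 2 with hg
  have hg0 : ∀ w x, 0 ≤ g w x := fun w x => sq_nonneg _
  have hgc : ∀ w, Continuous (g w) := fun w => ((hw w).continuous.norm).pow 2
  -- pointwise Jensen `(∑ g_w)³ ≤ N² ∑ g_w³`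
  have hpt : ∀ x, (∑ w, g w x) ^ 3 ≤ (N : ℝ) ^ 2 * ∑ w, g w x ^ 3 := fun x => by
    have := pow_sum_le_card_mul_sum_pow (s := (Finset.univ : Finset (Fin n → d))) (f := fun w => g w x)
      (fun w _ => hg0 w x) 2
    simpa [hN] using this
  -- integrate
  have hi1 : Integrable (fun x => (∑ w, g w x) ^ 3) :=
    ((continuous_finsetSum _ fun w _ => hgc w).pow 3).integrable_unitAddTorus
  have hi2 : Integrable (fun x => (N : ℝ) ^ 2 * ∑ w, g w x ^ 3) :=
    ((continuous_finsetSum _ fun w _ => (hgc w).pow 3).const_mul _).integrable_unitAddTorus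
  have hI : ∫ x, (∑ w, g w x) ^ 3 ≤ ∫ x, (N : ℝ) ^ 2 * ∑ w, g w x ^ 3 :=
    integral_mono hi1 hi2 hpt
  rw [MeasureTheory.integral_const_mul,
    integral_finsetSum Finset.univ (f := fun w x => g w x ^ 3)
      (fun w _ => ((hgc w).pow 3).integrable_unitAddTorus)] at hI
  -- each word: `∫ g_w³ = ∫ ‖∂^w v‖⁶ ≤ C₆ E_1(∂^w v)³`
  have hword : ∀ w : Fin n → d, ∫ x, g w x ^ 3 ≤ C₆ * torusHsEnergy 1 (wordDeriv (List.ofFn w) v) ^ 3 := by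
    intro w
    have h := h₆ _ (hw w) (hasZeroMean_wordDeriv hv hmean _)
    rw [← torusHsEnergy_one (hw w)] at h
    have e : ∫ x, g w x ^ 3 = ∫ x, ‖wordDeriv (List.ofFn w) v x‖ ^ 6 :=
      integral_congr_ae (ae_of_all _ fun x => by simp only [hg]; ring)
    rw [e]; exact h
  have hsum : ∑ w, ∫ x, g w x ^ 3 ≤ C₆ * ∑ w : Fin n → d, torusHsEnergy 1 (wordDeriv (List.ofFn w) v) ^ 3 := by
    rw [Finset.mul_sum]; exact Finset.sum_le_sum fun w _ => hword w
  have hcube : ∑ w : Fin n → d, torusHsEnergy 1 (wordDeriv (List.ofFn w) v) ^ 3 ≤ torusHsEnergy (n + 1) v ^ 3 := by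
    have h := sum_pow_three_le_pow_sum (Finset.univ : Finset (Fin n → d))
      (a := fun w => torusHsEnergy 1 (wordDeriv (List.ofFn w) v))
      (fun w _ => torusHsEnergy_nonneg zero_le_one (hw w))
    rw [sum_torusHsEnergy_wordDeriv hv n zero_le_one, show (1 : ℝ) + n = n + 1 by ring] at h
    exact h
  have hN0 : (0 : ℝ) ≤ (N : ℝ) ^ 2 := by positivity
  calc ∫ x, (∑ w, g w x) ^ 3 ≤ (N : ℝ) ^ 2 * ∑ w, ∫ x, g w x ^ 3 := hI
    _ ≤ (N : ℝ) ^ 2 * (C₆ * torusHsEnergy (n + 1) v ^ 3) :=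
        mul_le_mul_of_nonneg_left (hsum.trans (mul_le_mul_of_nonneg_left hcube hC₆)) hN0
    _ = (N : ℝ) ^ 2 * C₆ * torusHsEnergy (n + 1) v ^ 3 := by ring

/-! ## 5. Column `m = 1` of the chessboard in Gibbon's notation -/

/-- **`∫₀ᵀ H_n(u(t))^{1/(2n−1)} dt ≤ K(1+T)`, `H_n = ∫|∇ⁿu|² = wordEnergy n`** (Foias–Guillopé–Temam
1981 Thm 3.1 = column `m = 1` of Gibbon's chessboard, every `n ≥ 1`): for `ν > 0`, `M ≥ 0` there is
`K ≥ 0` such that along every classical zero-mean solution of unforced Navier–Stokes on `[0, T] × T³`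
with `‖u(0)‖₂² ≤ M`, `∫₀ᵀ (wordEnergy n (u t))^{1/(2n−1)} dt ≤ K (1 + T)`. A priori bound in the energy
class; no regularity claim. [cite: FoiasGuillopeTemam1981, Thm 3.1]
[cite: Gibbon2019Chessboard, Thm 1, Table 1 (column m = 1)] (classical solutions; ours) -/
theorem timeAverage_wordEnergy_le {n : ℕ} (hn : 1 ≤ n) {ν M : ℝ} (hν : 0 < ν) (hM : 0 ≤ M) :
    ∃ K : ℝ, 0 ≤ K ∧ ∀ {T : ℝ}, 0 < T →
      ∀ {u : ℝ → UnitAddTorus (Fin 3) → EuclideanSpace ℝ (Fin 3)} {p : ℝ → UnitAddTorus (Fin 3) → ℝ},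
      IsClassicalNSSolutionOn (Icc 0 T) ν 0 u p → (∀ t ∈ Icc 0 T, HasZeroMean (u t)) →
        ∫ x, ‖u 0 x‖ ^ 2 ≤ M →
          ∫ t in (0 : ℝ)..T, wordEnergy n (u t) ^ (2 * (n : ℝ) - 1)⁻¹ ≤ K * (1 + T) := by
  obtain ⟨K, hK0, hK⟩ := HsTimeAverages.timeAverage_le_nat hn hν hM
  refine ⟨K, hK0, fun {T} hT u p h hmean hu0 => ?_⟩
  have h1 := hK hT h hmean hu0
  have e : ∫ t in (0 : ℝ)..T, wordEnergy n (u t) ^ (2 * (n : ℝ) - 1)⁻¹ =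
      ∫ t in (0 : ℝ)..T, torusHsEnergy (n : ℝ) (u t) ^ (2 * (n : ℝ) - 1)⁻¹ :=
    intervalIntegral.integral_congr fun t ht => by
      have ht' : t ∈ Icc 0 T := by rwa [uIcc_of_le hT.le] at ht
      show wordEnergy n (u t) ^ (2 * (n : ℝ) - 1)⁻¹ = torusHsEnergy (n : ℝ) (u t) ^ (2 * (n : ℝ) - 1)⁻¹
      rw [wordEnergy_eq_torusHsEnergy n (h.smooth_velocity.isSmooth_slice ht')]
  rw [e]; exact h1

end HsWordEnergy

end Summit.NavierStokesRegularity.FunctionalMining
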